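import Literature.Computability.AlgebraicComplexity.LMR13PLambdaDualSubset
import Literature.Computability.AlgebraicComplexity.LMR13SegreDimensionProofs
import HarnessLib

/-!
# `dim Z(P_Λ)^* = 2n − 2`: the dual variety of the LMR boundary hypersurface has the dimension of `Z(det_n)^∨` — PROOF

Topic `Literature/Computability/AlgebraicComplexity`; theorems only (cell `val-lit`, seat t12 g3, item
(o2) of lead-lmr; bears on the statement source Landsberg–Manivel–Ressayre 2013 = DAG row LMR13-A,
§3.5). Honest framing: an elementary dimension count for a 2013 boundary form and its sorry-free
proof; **`VP ≠ VNP` is NOT proved and nothing here is progress on it.**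

**Source.** J. M. Landsberg, L. Manivel, N. Ressayre, *Hypersurfaces with degenerate duals and the
Geometric Complexity Theory Program*, Comment. Math. Helv. **88** (2013) 469–484, §3.5 (journal
p. 481; arXiv:1004.4802 `paper:arxiv-1004.4802 p0008.txt:L101–105, p0009.txt:L1–7`). After
Prop. 3.5.2 ("The dual variety of the hypersurface `Z(P_Λ)` is isomorphic to the Zariski closure of
`ℙ{v² ⊕ v∧w ∈ S²ℂⁿ ⊕ Λ²ℂⁿ, v, w ∈ ℂⁿ} ⊂ ℙ(M_n(ℂ))`") the text continues (`p0009.txt:L1–5`): "As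
expected, `Z(P_Λ)^*` is close to being a Segre product `ℙ^{n−1} × ℙ^{n−1}`. It can be defined as the
image of the projective bundle `π : ℙ(E) → ℙ^{n−1}`, where `E = 𝒪(−1) ⊕ Q` is the sum of the
tautological and quotient bundles on `ℙ^{n−1}`, by a sub-linear system of `𝒪_E(1) ⊗ π^*𝒪(1)`."
Since `rank E = n`, `dim ℙ(E) = 2n − 2`, and the sub-linear system contracts only the divisor `ℙ(Q)`,
the printed consequence is **`dim Z(P_Λ)^* = 2n − 2 = dim Z(det_n)^∨`** — "as expected" because
`[P_Λ]` is a point of `\overline{GL(W)·[det_n]}` (Prop. 3.5.1) at which the dual "remains of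
dimension `2n − 2`" (§3.3, `p0006.txt:L11`).

## What is here (all PROVED; no definition, no named fact)

* `dualVarietyDim_pLambda` — **`dualVarietyDim (pLambda n) = 2 * n - 2`** for `n` odd, `n ≥ 3`
  (`dualVarietyDim`, `pLambda` of `LMR13DualVarieties.lean`), and
  `dualVarietyDim_pLambda_eq_dualVarietyDim_detPoly` (`= dualVarietyDim det_n`, with
  `dualVarietyDim_detPoly` of `LMR13SegreDimensionProofs.lean`).
* `PLambdaDualDim.affineDimension_vSqWedgeSet` — the affine cone `{v² ⊕ v ∧ w : v, w ∈ ℂⁿ}`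
  (`vSqWedgeSet n`) has dimension (`affineDimension`) `2n − 1` for `n ≥ 1`.
* `rank_hessianMatrix_pLambda_of_irreducible` — B. Segre's formula (`segreDimension_core`) then
  gives: IF `P_Λ` is irreducible, `rank H_{P_Λ,y} ≤ 2n` on the cone `Z(P_Λ)` with equality on a
  non-empty open subset. The irreducibility of `P_Λ` is an explicit hypothesis (it is not in the tree);
  nothing is assumed as a fact.
* Generic tools (namespace `PLambdaDualDim`, reusable for other images of polynomial maps):
  `vanishingIdeal_zariskiClosure`, `vanishingIdeal_eq_of_subset_of_subset_zariskiClosure`,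
  `affineDimension_eq_of_vanishingIdeal_eq`, `vanishingIdeal_range_eq_ker` (the ideal of the image
  `{(φ_t(a))_t : a}` of a polynomial map is `ker (X_t ↦ φ_t)`), `affineDimension_range_eq_card` (its
  dimension is the size of a transcendence basis of `ℂ[φ_t : t]`, Matsumura Thm 5.6 via the tree's
  `ringKrullDim_eq_card_of_isTranscendenceBasis`), `isTranscendenceBasis_of_vectorField` (an
  algebraically independent family of size `|ι| − 1` in `ℂ[φ] ⊆ ℂ[X_ι]` is a transcendence basis as
  soon as one non-zero vector field kills every `φ_t` — Humphreys' Jacobian criterion,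
  `algebraicIndependent_iff_det_jacobianMatrix_ne_zero` of `Literature.Algebra.Polynomial.JacobianCriterion`).

## Proof (ours; the printed sentence gives the bundle description only)

By Prop. 3.5.2 as PROVED in `LMR13PLambdaDualSubset.lean` (val-lit p7: `tangentHyperplaneCone_pLambda_subset`
and `vSqWedgeSet_subset_dualVarietyCone_pLambda`, no change of coordinates) the cone of tangent
hyperplanes `THC(P_Λ)` satisfies `THC ⊆ {v² ⊕ v∧w} ⊆ \overline{THC}`, so both have the same vanishing
ideal and `dualVarietyDim (pLambda n) = affineDimension (vSqWedgeSet n) − 1`. The set `{v² ⊕ v∧w}` is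
the image of `(v, w) ↦ (f_{ij}) = (v_i v_j + v_i w_j − v_j w_i)_{ij}`, so its coordinate ring is the
affine domain `ℂ[f_{ij}] ⊆ ℂ[v, w]` and its dimension is the transcendence degree of `ℂ[f_{ij}]`. The
`2n − 1` elements `f_{ii} = v_i²` (`i < n`) and `f_{0j} − f_{j0} = 2(v_0 w_j − v_j w_0)` (`0 < j < n`)
are algebraically independent: adjoining `w_0`, the `2n × 2n` Jacobian matrix at `v = (1,…,1)`,
`w = 0` is block lower-triangular with diagonal `2,…,2, 1, 2,…,2`. They form a transcendence basis
because the vector field `ξ = Σ_i v_i ∂/∂w_i` (tangent to the fibres `w ↦ w + t v` of the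
parametrisation) kills every `f_{ij}`, hence all of `ℂ[f_{ij}]` (chain rule), so any `2n` elements of
`ℂ[f_{ij}]` have a singular Jacobian matrix and are algebraically dependent (Jacobian criterion).
Hence `affineDimension (vSqWedgeSet n) = 2n − 1` and `dualVarietyDim (pLambda n) = 2n − 2`.

## References

* [LandsbergManivelRessayre2013] J. M. Landsberg, L. Manivel, N. Ressayre, Comment. Math. Helv. 88
  (2013) 469–484, §3.5, Prop. 3.5.2 and the paragraph following it (p. 481); arXiv:1004.4802.
* [Matsumura1987] H. Matsumura, *Commutative Ring Theory*, CUP 1986, Thm 5.6 (`dim = trdeg` for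
  affine domains).
* [Humphreys1990] J. E. Humphreys, *Reflection Groups and Coxeter Groups*, CUP 1990, § 3.10
  (Jacobian criterion).
* [Hartshorne1977] R. Hartshorne, *Algebraic Geometry*, GTM 52, I §1 (Zariski closure, vanishing
  ideals, Prop. 1.7: dimension of an affine algebraic set).
-/

noncomputable section

namespace Literature.Computability.AlgebraicComplexity

open MvPolynomial Finset Matrix Literature.Algebra.Polynomial.JacobianCriterion
  Literature.RingTheory.KrullDimension

namespace PLambdaDualDim

/-! ### Generic: the affine dimension of the image of a polynomial map -/

section Generic

variable {ι τ : Type*}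

/-- The Zariski closure does not change the vanishing ideal: `I(\overline{S}) = I(S)`.
[cite: Hartshorne1977, I §1 (p. 3)] -/
theorem vanishingIdeal_zariskiClosure (S : Set (τ → ℂ)) :
    MvPolynomial.vanishingIdeal ℂ (zariskiClosure S) = MvPolynomial.vanishingIdeal ℂ S := by
  refine le_antisymm (MvPolynomial.vanishingIdeal_anti_mono (subset_zariskiClosure S)) ?_
  intro p hp
  rw [mem_vanishingIdeal_iff] at hp ⊢
  intro x hx
  rw [mem_zariskiClosure_iff] at hx
  exact hx p hp

/-- `affineDimension` depends only on the vanishing ideal (it is the Krull dimension of `ℂ[X] ⧸ I(S)`).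
[cite: Hartshorne1977, I §1 Prop. 1.7 (p. 6)] -/
theorem affineDimension_eq_of_vanishingIdeal_eq {S T : Set (τ → ℂ)}
    (h : MvPolynomial.vanishingIdeal ℂ S = MvPolynomial.vanishingIdeal ℂ T) :
    affineDimension S = affineDimension T := by
  rw [affineDimension, affineDimension, h]

/-- If `S ⊆ T ⊆ \overline{S}` then `S` and `T` have the same vanishing ideal.
[cite: Hartshorne1977, I §1 (p. 3)] -/
theorem vanishingIdeal_eq_of_subset_of_subset_zariskiClosure {S T : Set (τ → ℂ)} (h₁ : S ⊆ T)
    (h₂ : T ⊆ zariskiClosure S) :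
    MvPolynomial.vanishingIdeal ℂ S = MvPolynomial.vanishingIdeal ℂ T := by
  refine le_antisymm ?_ (MvPolynomial.vanishingIdeal_anti_mono h₁)
  rw [← vanishingIdeal_zariskiClosure S]
  exact MvPolynomial.vanishingIdeal_anti_mono h₂

/-- The vanishing ideal of the image `{(φ_t(a))_t : a ∈ ℂ^ι}` of a polynomial map `ℂ^ι → ℂ^τ` is the
kernel of the comorphism `ℂ[X_τ] → ℂ[X_ι]`, `X_t ↦ φ_t` (`ℂ` is infinite, so a polynomial
vanishing at all points of `ℂ^ι` is zero). [cite: Hartshorne1977, I §1 (p. 3) and I §3 (morphisms)] -/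
theorem vanishingIdeal_range_eq_ker (φ : τ → MvPolynomial ι ℂ) :
    MvPolynomial.vanishingIdeal ℂ {x : τ → ℂ | ∃ a : ι → ℂ, x = fun t => eval a (φ t)} =
      RingHom.ker (aeval φ : MvPolynomial τ ℂ →ₐ[ℂ] MvPolynomial ι ℂ) := by
  ext p
  rw [mem_vanishingIdeal_iff, RingHom.mem_ker]
  constructor
  · intro h
    apply MvPolynomial.funext
    intro a
    rw [eval_aeval_eq_eval, map_zero]
    have := h _ ⟨a, rfl⟩
    exact this
  · rintro h x ⟨a, rfl⟩
    show eval (fun t => eval a (φ t)) p = 0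
    rw [← eval_aeval_eq_eval, h, map_zero]

variable [Fintype ι] [Fintype τ]

omit [Fintype ι] in
/-- **Dimension of the image of a polynomial map = size of a transcendence basis of its coordinate
ring.** For `φ : τ → ℂ[X_ι]` and a transcendence basis `x : κ → ℂ[φ]` (`κ` finite) of the image
subalgebra `ℂ[φ_t : t] = range (aeval φ) ⊆ ℂ[X_ι]` over `ℂ`, the Zariski closure of the image
`{(φ_t(a))_t}` has dimension `|κ|` (its coordinate ring is `ℂ[X_τ] ⧸ ker = ℂ[φ]`, an affine domain;
Matsumura Thm 5.6). [cite: Matsumura1987, Thm 5.6] -/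
theorem affineDimension_range_eq_card {κ : Type*} [Fintype κ] (φ : τ → MvPolynomial ι ℂ)
    {x : κ → (aeval φ : MvPolynomial τ ℂ →ₐ[ℂ] MvPolynomial ι ℂ).range}
    (hx : IsTranscendenceBasis ℂ x) :
    affineDimension {x : τ → ℂ | ∃ a : ι → ℂ, x = fun t => eval a (φ t)} = Fintype.card κ := by
  set Φ : MvPolynomial τ ℂ →ₐ[ℂ] MvPolynomial ι ℂ := aeval φ with hΦ
  haveI : Algebra.FiniteType ℂ Φ.range :=
    Algebra.FiniteType.of_surjective Φ.rangeRestrict Φ.rangeRestrict_surjective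
  have e : (MvPolynomial τ ℂ ⧸ MvPolynomial.vanishingIdeal ℂ
      {x : τ → ℂ | ∃ a : ι → ℂ, x = fun t => eval a (φ t)}) ≃ₐ[ℂ] Φ.range :=
    (Ideal.quotientEquivAlgOfEq ℂ
        ((vanishingIdeal_range_eq_ker φ).trans (AlgHom.ker_rangeRestrict Φ).symm)).trans
      (Ideal.quotientKerAlgEquivOfSurjective Φ.rangeRestrict_surjective)
  rw [affineDimension, ringKrullDim_eq_of_ringEquiv e.toRingEquiv,
    ringKrullDim_eq_card_of_isTranscendenceBasis ℂ Φ.range hx, ← WithBot.coe_natCast,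
    WithBot.unbotD_coe, ENat.toNat_coe]

/-- A "vector field" `ξ = Σ_k ξ_k ∂/∂X_k` killing every `φ_t` kills the whole image subalgebra `ℂ[φ]`
(chain rule, Humphreys § 3.10 display (23)). [cite: Humphreys1990, § 3.10 (display (23))] -/
theorem sum_mul_pderiv_eq_zero_of_mem_range (φ : τ → MvPolynomial ι ℂ) (ξ : ι → MvPolynomial ι ℂ)
    (hξ : ∀ t, ∑ k, ξ k * pderiv k (φ t) = 0) {f : MvPolynomial ι ℂ}
    (hf : f ∈ (aeval φ : MvPolynomial τ ℂ →ₐ[ℂ] MvPolynomial ι ℂ).range) :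
    ∑ k, ξ k * pderiv k f = 0 := by
  rw [AlgHom.mem_range] at hf
  obtain ⟨p, rfl⟩ := hf
  have h1 : ∀ k, pderiv k (aeval φ p) = ∑ t, aeval φ (pderiv t p) * pderiv k (φ t) :=
    fun k => pderiv_aeval_eq_sum φ p k
  simp_rw [h1, Finset.mul_sum]
  rw [Finset.sum_comm]
  refine Finset.sum_eq_zero fun t _ => ?_
  have : ∑ k, ξ k * (aeval φ (pderiv t p) * pderiv k (φ t)) =
      aeval φ (pderiv t p) * ∑ k, ξ k * pderiv k (φ t) := by
    rw [Finset.mul_sum]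
    exact Finset.sum_congr rfl fun k _ => by ring
  rw [this, hξ t, mul_zero]

variable [DecidableEq ι]

/-- **Transcendence basis from Jacobian data.** Let `φ : τ → ℂ[X_ι]`, `|ι| = m + 1`, and let
`x : κ → ℂ[φ]`, `|κ| = m`, be algebraically independent over `ℂ`. If a non-zero vector field
`ξ = Σ_k ξ_k ∂/∂X_k` kills every `φ_t`, then `x` is a transcendence basis of `ℂ[φ]` over `ℂ`: for any
`f ∈ ℂ[φ]` the `m + 1` polynomials `f, x` have a Jacobian matrix with `ξ` in its kernel, hence zero
Jacobian determinant, hence (Humphreys § 3.10, the Jacobian criterion) they are algebraically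
dependent, so `f` is algebraic over `ℂ[x]`. [cite: Humphreys1990, § 3.10 Proposition] -/
theorem isTranscendenceBasis_of_vectorField {κ : Type*} [Fintype κ] {m : ℕ}
    (hκ : Fintype.card κ = m) (hι : Fintype.card ι = m + 1) (φ : τ → MvPolynomial ι ℂ)
    (x : κ → (aeval φ : MvPolynomial τ ℂ →ₐ[ℂ] MvPolynomial ι ℂ).range)
    (hx : AlgebraicIndependent ℂ fun i => (x i : MvPolynomial ι ℂ))
    (ξ : ι → MvPolynomial ι ℂ) (hξ0 : ξ ≠ 0) (hξ : ∀ t, ∑ k, ξ k * pderiv k (φ t) = 0) :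
    IsTranscendenceBasis ℂ x := by
  classical
  have hval : Function.Injective
      ((aeval φ : MvPolynomial τ ℂ →ₐ[ℂ] MvPolynomial ι ℂ).range.val) := Subtype.val_injective
  have hx' : AlgebraicIndependent ℂ x :=
    AlgebraicIndependent.of_comp (aeval φ : MvPolynomial τ ℂ →ₐ[ℂ] MvPolynomial ι ℂ).range.val hx
  refine hx'.isTranscendenceBasis_iff_isAlgebraic.2 ⟨fun a => ?_⟩
  -- `a` together with `x` is algebraically dependent
  by_contra halg
  have hind : AlgebraicIndependent ℂ (fun o : Option κ => o.elim a x) :=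
    AlgebraicIndependent.option_iff.2 ⟨hx', halg⟩
  have hind' := hind.map' hval
  -- reindex by `ι`
  have hcard : Fintype.card ι = Fintype.card (Option κ) := by
    rw [Fintype.card_option, hκ, hι]
  obtain ⟨e⟩ : Nonempty (ι ≃ Option κ) := ⟨Fintype.equivOfCardEq hcard⟩
  have hzind := (algebraicIndependent_equiv e).2 hind'
  -- every member of the family lies in the image subalgebra, so `ξ` is in the kernel of the Jacobian
  have hJ : Matrix.mulVec (jacobianMatrix ((⇑(aeval φ : MvPolynomial τ ℂ →ₐ[ℂ] MvPolynomial ι ℂ).range.val ∘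
      fun o : Option κ => o.elim a x) ∘ ⇑e)) ξ = 0 := by
    funext k
    simp only [Matrix.mulVec, dotProduct, Pi.zero_apply, jacobianMatrix_apply, Function.comp_apply]
    have hmem : (((e k).elim a x : _) : MvPolynomial ι ℂ) ∈
        (aeval φ : MvPolynomial τ ℂ →ₐ[ℂ] MvPolynomial ι ℂ).range := ((e k).elim a x).2
    have := sum_mul_pderiv_eq_zero_of_mem_range φ ξ hξ hmem
    rw [← this]
    exact Finset.sum_congr rfl fun l _ => mul_comm _ _
  have hdet := Matrix.exists_mulVec_eq_zero_iff.mp ⟨ξ, hξ0, hJ⟩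
  exact (algebraicIndependent_iff_det_jacobianMatrix_ne_zero _).1 hzind hdet

end Generic

/-! ### The cone `{v² ⊕ v ∧ w}` has dimension `2n − 1` -/

section VSqWedge

/-- **`dim {v² ⊕ v ∧ w : v, w ∈ ℂⁿ} = 2n − 1`** (affine cone in `M_n(ℂ)`; LMR 2013, after Prop. 3.5.2:
"As expected, `Z(P_Λ)^*` is close to being a Segre product `ℙ^{n−1} × ℙ^{n−1}`. It can be defined as
the image of the projective bundle `π : ℙ(E) → ℙ^{n−1}`, where `E = 𝒪(−1) ⊕ Q`" — a bundle of rank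
`n` over `ℙ^{n−1}`, so of dimension `2n − 2` projectively; `paper:arxiv-1004.4802 p0009.txt:L1–4`,
journal p. 481). Proof (ours, elementary): the coordinate ring of the closure of the image of
`(v, w) ↦ (v_i v_j + v_i w_j − v_j w_i)_{ij}` is `ℂ[f_{ij}] ⊆ ℂ[v, w]`; the `2n − 1` elements
`v_i² = f_{ii}` and `f_{0j} − f_{j0} = 2(v_0 w_j − v_j w_0)` (`j ≠ 0`) are algebraically independent
(Jacobian criterion, with `w_0` adjoined), and form a transcendence basis because the vector field
`Σ_i v_i ∂/∂w_i` (the infinitesimal generator of `w ↦ w + t v`, which fixes `v²` and `v ∧ w`) kills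
every `f_{ij}` (`isTranscendenceBasis_of_vectorField`).
[cite: LandsbergManivelRessayre2013, Proposition 3.5.2 and the paragraph after it (p. 481)] -/
theorem affineDimension_vSqWedgeSet_succ (h : ℕ) :
    affineDimension (vSqWedgeSet (h + 1)) = 2 * h + 1 := by
  classical
  -- the parametrisation `φ`, variables `v = inl`, `w = inr`
  set φ : Fin (h + 1) × Fin (h + 1) → MvPolynomial (Fin (h + 1) ⊕ Fin (h + 1)) ℂ :=
    fun ij => X (Sum.inl ij.1) * X (Sum.inl ij.2) +
      (X (Sum.inl ij.1) * X (Sum.inr ij.2) - X (Sum.inl ij.2) * X (Sum.inr ij.1)) with hφ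
  have hS : vSqWedgeSet (h + 1) =
      {x : Fin (h + 1) × Fin (h + 1) → ℂ | ∃ a : Fin (h + 1) ⊕ Fin (h + 1) → ℂ,
        x = fun t => eval a (φ t)} := by
    ext M
    constructor
    · rintro ⟨v, w, hM⟩
      refine ⟨Sum.elim v w, funext fun ij => ?_⟩
      simp [hφ, hM ij.1 ij.2]
    · rintro ⟨a, rfl⟩
      exact ⟨fun i => a (Sum.inl i), fun i => a (Sum.inr i), fun i j => by simp [hφ]⟩
  rw [hS]
  -- the vector field `ξ = Σ_i v_i ∂/∂w_i`
  set ξ : Fin (h + 1) ⊕ Fin (h + 1) → MvPolynomial (Fin (h + 1) ⊕ Fin (h + 1)) ℂ :=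
    Sum.elim (fun _ => 0) (fun i => X (Sum.inl i)) with hξdef
  have hξ0 : ξ ≠ 0 := by
    intro h0
    have := congrFun h0 (Sum.inr 0)
    simp only [hξdef, Sum.elim_inr, Pi.zero_apply] at this
    exact X_ne_zero _ this
  have hpdφ : ∀ (i : Fin (h + 1)) (t : Fin (h + 1) × Fin (h + 1)),
      pderiv (Sum.inr i) (φ t) =
        X (Sum.inl t.1) * (if t.2 = i then 1 else 0) - X (Sum.inl t.2) * (if t.1 = i then 1 else 0) := by
    intro i t
    simp only [hφ, map_add, map_sub, Derivation.leibniz, pderiv_X, smul_eq_mul]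
    simp [Pi.single_apply, eq_comm]
  have hξ : ∀ t, ∑ k, ξ k * pderiv k (φ t) = 0 := by
    intro t
    rw [Fintype.sum_sum_type]
    simp only [hξdef, Sum.elim_inl, zero_mul, Finset.sum_const_zero, zero_add, Sum.elim_inr, hpdφ,
      mul_sub, mul_ite, mul_one, mul_zero, Finset.sum_sub_distrib, Finset.sum_ite_eq,
      Finset.mem_univ, if_true]
    ring
  -- the square family `z` (the `2n − 1` basis elements and `w_0`)
  set z : Fin (h + 1) ⊕ Fin (h + 1) → MvPolynomial (Fin (h + 1) ⊕ Fin (h + 1)) ℂ :=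
    Sum.elim (fun i => X (Sum.inl i) * X (Sum.inl i))
      (fun j => Fin.cases (X (Sum.inr 0))
        (fun j' => C 2 * (X (Sum.inl 0) * X (Sum.inr j'.succ) - X (Sum.inl j'.succ) * X (Sum.inr 0))) j)
    with hzdef
  -- its Jacobian at `v = 𝟙`, `w = 0`
  set a₀ : Fin (h + 1) ⊕ Fin (h + 1) → ℂ := Sum.elim (fun _ => 1) (fun _ => 0) with ha₀
  have hrow₁ : ∀ i k, eval a₀ (pderiv k (z (Sum.inl i))) =
      if (Sum.inl i : Fin (h + 1) ⊕ Fin (h + 1)) = k then 2 else 0 := by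
    intro i k
    simp only [hzdef, Sum.elim_inl, pderiv_mul, pderiv_X, Pi.single_apply, map_add, map_mul,
      eval_X, ha₀, Sum.elim_inl, one_mul, mul_one]
    split_ifs <;> norm_num
  have hrow₂ : ∀ k, eval a₀ (pderiv k (z (Sum.inr 0))) =
      if (Sum.inr 0 : Fin (h + 1) ⊕ Fin (h + 1)) = k then 1 else 0 := by
    intro k
    simp only [hzdef, Sum.elim_inr, Fin.cases_zero, pderiv_X, Pi.single_apply,
      apply_ite (eval a₀), map_one, map_zero]
  have hrow₃ : ∀ (j' : Fin h) k, eval a₀ (pderiv k (z (Sum.inr j'.succ))) =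
      2 * ((if (Sum.inr j'.succ : Fin (h + 1) ⊕ Fin (h + 1)) = k then 1 else 0) -
        (if (Sum.inr 0 : Fin (h + 1) ⊕ Fin (h + 1)) = k then 1 else 0)) := by
    intro j' k
    simp only [hzdef, Sum.elim_inr, Fin.cases_succ, map_sub, pderiv_mul, pderiv_X,
      Pi.single_apply, map_add, map_mul, eval_C, eval_X, apply_ite (eval a₀), map_one, map_zero]
    simp only [ha₀, Sum.elim_inl, Sum.elim_inr]
    split_ifs <;> norm_num
  set T : Matrix (Fin (h + 1)) (Fin (h + 1)) ℂ :=
    Matrix.of fun j k => Fin.cases (if (0 : Fin (h + 1)) = k then (1 : ℂ) else 0)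
      (fun j' => 2 * ((if j'.succ = k then 1 else 0) - (if (0 : Fin (h + 1)) = k then 1 else 0))) j
    with hT
  have hJ : (eval a₀).mapMatrix (jacobianMatrix z) =
      Matrix.fromBlocks ((2 : ℂ) • 1) 0 0 T := by
    ext j k
    rw [RingHom.mapMatrix_apply, Matrix.map_apply, jacobianMatrix_apply]
    rcases j with i | j
    · rcases k with k | k
      · rw [hrow₁, Matrix.fromBlocks_apply₁₁, Matrix.smul_apply, Matrix.one_apply]
        simp
      · rw [hrow₁, Matrix.fromBlocks_apply₁₂]
        simp
    · refine Fin.cases ?_ (fun j' => ?_) j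
      · rcases k with k | k
        · rw [hrow₂, Matrix.fromBlocks_apply₂₁]
          simp
        · rw [hrow₂, Matrix.fromBlocks_apply₂₂, hT, Matrix.of_apply, Fin.cases_zero]
          simp
      · rcases k with k | k
        · rw [hrow₃, Matrix.fromBlocks_apply₂₁]
          simp
        · rw [hrow₃, Matrix.fromBlocks_apply₂₂, hT, Matrix.of_apply, Fin.cases_succ]
          simp
  have hTtri : T.BlockTriangular ⇑OrderDual.toDual := by
    intro j k hjk
    have hjk' : j < k := hjk
    rw [hT, Matrix.of_apply]
    revert hjk'
    refine Fin.cases ?_ (fun j' => ?_) j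
    · intro hlt
      have hk : (0 : Fin (h + 1)) ≠ k := ne_of_lt hlt
      simp [hk]
    · intro hlt
      have hk1 : j'.succ ≠ k := ne_of_lt hlt
      have hk0 : (0 : Fin (h + 1)) ≠ k := fun hk0 => by
        rw [← hk0] at hlt; exact (Fin.not_lt_zero _ hlt).elim
      simp [hk1, hk0]
  have hTdet : T.det ≠ 0 := by
    rw [Matrix.det_of_lowerTriangular T hTtri]
    refine Finset.prod_ne_zero_iff.2 fun j _ => ?_
    rw [hT, Matrix.of_apply]
    refine Fin.cases ?_ (fun j' => ?_) j
    · simp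
    · simp [(Fin.succ_ne_zero j').symm]
  have hdet : (jacobianMatrix z).det ≠ 0 := by
    intro h0
    have h1 := RingHom.map_det (eval a₀) (jacobianMatrix z)
    rw [h0, map_zero, hJ, Matrix.det_fromBlocks_zero₁₂, Matrix.det_smul, Matrix.det_one,
      mul_one] at h1
    exact mul_ne_zero (pow_ne_zero _ two_ne_zero) hTdet h1.symm
  have hz : AlgebraicIndependent ℂ z :=
    (algebraicIndependent_iff_det_jacobianMatrix_ne_zero z).2 hdet
  -- the basis `x` inside the image subalgebra
  have hmem₁ : ∀ i : Fin (h + 1), X (Sum.inl i) * X (Sum.inl i) ∈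
      (aeval φ : MvPolynomial (Fin (h + 1) × Fin (h + 1)) ℂ →ₐ[ℂ]
        MvPolynomial (Fin (h + 1) ⊕ Fin (h + 1)) ℂ).range := fun i =>
    (AlgHom.mem_range _).2 ⟨X (i, i), by rw [aeval_X]; simp only [hφ]; ring⟩
  have hmem₂ : ∀ j' : Fin h,
      C 2 * (X (Sum.inl 0) * X (Sum.inr j'.succ) - X (Sum.inl j'.succ) * X (Sum.inr 0)) ∈
      (aeval φ : MvPolynomial (Fin (h + 1) × Fin (h + 1)) ℂ →ₐ[ℂ]
        MvPolynomial (Fin (h + 1) ⊕ Fin (h + 1)) ℂ).range := fun j' =>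
    (AlgHom.mem_range _).2 ⟨X ((0 : Fin (h + 1)), j'.succ) - X (j'.succ, (0 : Fin (h + 1))), by
      rw [map_sub, aeval_X, aeval_X]; simp only [hφ, map_ofNat]; ring⟩
  set x : Fin (h + 1) ⊕ Fin h →
      (aeval φ : MvPolynomial (Fin (h + 1) × Fin (h + 1)) ℂ →ₐ[ℂ]
        MvPolynomial (Fin (h + 1) ⊕ Fin (h + 1)) ℂ).range :=
    Sum.elim (fun i => ⟨_, hmem₁ i⟩) (fun j' => ⟨_, hmem₂ j'⟩) with hxdef
  have hxz : (fun k => (x k : MvPolynomial (Fin (h + 1) ⊕ Fin (h + 1)) ℂ)) =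
      z ∘ Sum.map id Fin.succ := by
    funext k
    rcases k with i | j'
    · simp [hxdef, hzdef]
    · simp [hxdef, hzdef]
  have hx : AlgebraicIndependent ℂ fun k => (x k : MvPolynomial (Fin (h + 1) ⊕ Fin (h + 1)) ℂ) := by
    rw [hxz]
    exact hz.comp _ (Sum.map_injective.2 ⟨Function.injective_id, Fin.succ_injective _⟩)
  have hbasis : IsTranscendenceBasis ℂ x :=
    isTranscendenceBasis_of_vectorField (m := 2 * h + 1)
      (by simp only [Fintype.card_sum, Fintype.card_fin]; omega)
      (by simp only [Fintype.card_sum, Fintype.card_fin]; omega) φ x hx ξ hξ0 hξ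
  rw [affineDimension_range_eq_card φ hbasis, Fintype.card_sum, Fintype.card_fin, Fintype.card_fin]
  omega

/-- **`dim {v² ⊕ v ∧ w} = 2n − 1`** for every `n ≥ 1` (`affineDimension_vSqWedgeSet_succ`).
[cite: LandsbergManivelRessayre2013, Proposition 3.5.2 (p. 481)] -/
theorem affineDimension_vSqWedgeSet {n : ℕ} (hn : 1 ≤ n) :
    affineDimension (vSqWedgeSet n) = 2 * n - 1 := by
  obtain ⟨h, rfl⟩ : ∃ h, n = h + 1 := ⟨n - 1, by omega⟩
  rw [affineDimension_vSqWedgeSet_succ]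
  omega

end VSqWedge

/-! ### `dim Z(P_Λ)^* = 2n − 2` -/

section PLambda

/-- The cone of tangent hyperplanes of `Z(P_Λ)` and the cone `{v² ⊕ v ∧ w}` have the same vanishing
ideal (hence the same Zariski closure and dimension): `THC(P_Λ) ⊆ {v² ⊕ v∧w} ⊆ Z(P_Λ)^* =
\overline{THC(P_Λ)}` by the two halves of LMR Prop. 3.5.2 PROVED in `LMR13PLambdaDualSubset.lean`
(`tangentHyperplaneCone_pLambda_subset`, `vSqWedgeSet_subset_dualVarietyCone_pLambda`), `n = 2h+1 ≥ 3`.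
[cite: LandsbergManivelRessayre2013, Proposition 3.5.2 (p. 481)] -/
theorem vanishingIdeal_tangentHyperplaneCone_pLambda (h : ℕ) (hh : 0 < h) :
    MvPolynomial.vanishingIdeal ℂ (tangentHyperplaneCone (pLambda (h + h + 1))) =
      MvPolynomial.vanishingIdeal ℂ (vSqWedgeSet (h + h + 1)) :=
  vanishingIdeal_eq_of_subset_of_subset_zariskiClosure
    (tangentHyperplaneCone_pLambda_subset ⟨h, by omega⟩)
    (vSqWedgeSet_subset_dualVarietyCone_pLambda h hh)

/-- Hence the affine cones over `Z(P_Λ)^*` and over `\overline{ℙ{v² ⊕ v∧w}}` have the same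
dimension. [cite: LandsbergManivelRessayre2013, Proposition 3.5.2 (p. 481)] -/
theorem affineDimension_tangentHyperplaneCone_pLambda (h : ℕ) (hh : 0 < h) :
    affineDimension (tangentHyperplaneCone (pLambda (h + h + 1))) = 2 * (h + h + 1) - 1 := by
  rw [affineDimension_eq_of_vanishingIdeal_eq (vanishingIdeal_tangentHyperplaneCone_pLambda h hh),
    affineDimension_vSqWedgeSet (by omega)]

end PLambda

end PLambdaDualDim

open PLambdaDualDim in
/-- **`dim Z(P_Λ)^* = 2n − 2`** for `n` odd, `n ≥ 3` — the dual variety of the LMR boundary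
hypersurface `Z(P_Λ) ⊂ ℙ M_n(ℂ)` has (projective) dimension `2n − 2`, the same as
`Z(det_n)^∨ = Seg(ℙ^{n−1} × ℙ^{n−1})` (LMR 2013, p. 481, right after Prop. 3.5.2: "As expected,
`Z(P_Λ)^*` is close to being a Segre product `ℙ^{n−1} × ℙ^{n−1}`. It can be defined as the image of the
projective bundle `π : ℙ(E) → ℙ^{n−1}`, where `E = 𝒪(−1) ⊕ Q` is the sum of the tautological and
quotient bundles on `ℙ^{n−1}`, by a sub-linear system of `𝒪_E(1) ⊗ π^*𝒪(1)`" — `rank E = n`, so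
`dim ℙ(E) = 2n − 2`; `paper:arxiv-1004.4802 p0009.txt:L1–5`). PROVED: Prop. 3.5.2 (both inclusions,
`LMR13PLambdaDualSubset.lean`, val-lit p7) identifies the vanishing ideal of the cone of tangent
hyperplanes with that of `{v² ⊕ v ∧ w : v, w ∈ ℂⁿ}`, whose closure has affine dimension `2n − 1`
(`affineDimension_vSqWedgeSet`: transcendence basis `v_i²`, `v_0 w_j − v_j w_0` of `ℂ[v², v ∧ w]`,
Jacobian criterion); `dualVarietyDim = affineDimension − 1`. With `dualVarietyDim_detPoly`
(`= 2n − 2`, `LMR13SegreDimensionProofs.lean`) this is the printed "as expected": the boundary point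
`[P_Λ]` of `\overline{GL·det_n}` keeps a dual of the same dimension as `det_n` (cf. §3.3, "subject
to the condition that its dual remains of dimension `2n − 2`", `p0006.txt:L11`).
[cite: LandsbergManivelRessayre2013, Proposition 3.5.2 and sequel (p. 481)] -/
theorem dualVarietyDim_pLambda {n : ℕ} (hn : Odd n) (h3 : 3 ≤ n) :
    dualVarietyDim (pLambda n) = 2 * n - 2 := by
  obtain ⟨h, rfl⟩ : ∃ h, n = h + h + 1 := by
    obtain ⟨k, hk⟩ := hn
    exact ⟨k, by omega⟩
  have hh : 0 < h := by omega
  rw [dualVarietyDim, affineDimension_tangentHyperplaneCone_pLambda h hh]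
  omega

open PLambdaDualDim in
/-- `dim Z(P_Λ)^* = dim Z(det_n)^∨` (`= 2n − 2`) for `n` odd, `n ≥ 3`: the degeneration
`det_n ⇝ P_Λ` of Prop. 3.5.1 preserves the dimension of the dual variety (LMR 2013, p. 481 "as
expected"; §3.3). [cite: LandsbergManivelRessayre2013, Proposition 3.5.2 and sequel (p. 481)] -/
theorem dualVarietyDim_pLambda_eq_dualVarietyDim_detPoly {n : ℕ} (hn : Odd n) (h3 : 3 ≤ n) :
    dualVarietyDim (pLambda n) = dualVarietyDim (detPoly (Fin n) ℂ) := by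
  rw [dualVarietyDim_pLambda hn h3, dualVarietyDim_detPoly (by omega)]

/-! ### The Hessian of `P_Λ` on `Z(P_Λ)` (B. Segre's formula), granted irreducibility of `P_Λ` -/

open PLambdaDualDim in
/-- **Generic Hessian rank of `P_Λ` on its zero set is `2n`, GRANTED `P_Λ` irreducible** (B. Segre's
formula `dim Z(P)^* = rank H_{P,w} − 2` at a general point, `segreDimension_core` /
`segreDimensionFormula_holds`, combined with `dualVarietyDim_pLambda`): for `n` odd, `n ≥ 3`, IF
`pLambda n` is irreducible then `rank H_{P_Λ, y} ≤ 2n` at EVERY `y ∈ Z(P_Λ)` and `= 2n` on a non-empty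
Zariski-open subset `{g ≠ 0}` of the cone `Z(P_Λ)`. The irreducibility of `P_Λ = ∑ s_{ij} Pf_i(A) Pf_j(A)`
(LMR p. 480) is NOT proved in the tree and is an explicit hypothesis here (no fact is introduced);
compare `rank_hessianMatrix_detPoly_le` / `dualVarietyDim_detPoly` for `det_n` (rank `2n` at corank-one
matrices). [cite: LandsbergManivelRessayre2013, §2.1 and Proposition 3.5.2 (pp. 471, 481); Landsberg2017, Prop. 6.4.5.1] -/
theorem rank_hessianMatrix_pLambda_of_irreducible {n : ℕ} (hn : Odd n) (h3 : 3 ≤ n)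
    (hirr : Irreducible (pLambda n)) :
    (∀ y : Fin n × Fin n → ℂ, eval y (pLambda n) = 0 → (hessianMatrix (pLambda n) y).rank ≤ 2 * n) ∧
    ∃ g : MvPolynomial (Fin n × Fin n) ℂ,
      (∃ y, eval y (pLambda n) = 0 ∧ eval y g ≠ 0) ∧
      ∀ y, eval y (pLambda n) = 0 → eval y g ≠ 0 → (hessianMatrix (pLambda n) y).rank = 2 * n := by
  obtain ⟨m, g, hdim, -, hex, hle, hge⟩ :=
    segreDimension_core (by omega) (pLambda_isHomogeneous hn) hirr
  have hm : m + 1 = 2 * n := by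
    have h1 := dualVarietyDim_pLambda hn h3
    rw [dualVarietyDim, hdim] at h1
    omega
  refine ⟨fun y hy => hm ▸ hle y hy, g, hex, fun y hy hgy => ?_⟩
  rw [← hm]
  exact le_antisymm (hle y hy) (hge y hy hgy)

end Literature.Computability.AlgebraicComplexity

end
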